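import Summits.CriticalPhenomena.SAWScalingLimit.Theorems.SAWLoopFugacityFlowIsingBoundaryRatioWindowRectOrder
import HarnessLib

/-!
# Window rectangle: valleys, peaks and excursions of the height along the boundary cycle
(line `fk-anchor-transfer`, crux `IsingBoundaryRatio`, stmt-CriticalPhenomena-10650; helper file of the stub
`windowRectPresentation_holds : WindowRectPresentation`)

In the static setting `X : WSetting`, four consequences of the feet probe `…WindowRectProbes.false_of_far`
phrased with heights (`false_of_heights`: rough positions `a < b < c < e < a + N`, `a, b, c` of one hand,
`a, c` at one level, `b` off that level by `m/2`, and `e` off it too if of the same hand, do not exist):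
* `hands_ne_of_valley` — a descent of the height from high to low followed by an ascent from low to high are
  of different hands;
* `hands_ne_of_peak` — the same for an ascent followed by a descent;
* `false_of_low_excursion` — between two low positions joined through mid positions the height does not
  reach `w₁ + 3m` (given a rough position of height `≥ w₁ + 3m` elsewhere);
* `false_of_high_excursion` — the mirror statement below `w₂ - 3m`.
[folklore]
-/

noncomputable section

open scoped Classical Topology Real
open Filter Set Metric Complex
open Literature.Probability.LatticeModels Literature.Probability.RandomPlanarGeometry
open Literature.Probability.LatticeModels.DiscreteRect Literature.Topology.PlaneTopology
open UpperHalfPlane (upperHalfPlaneSet)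

namespace Summit.CriticalPhenomena.SAWScalingLimit.Theorems.IsingBoundaryRatio

namespace WindowRect

namespace WSetting

variable (X : WSetting)

/-- Numerology of the setting used below. [folklore] -/
theorem numer : 0 < X.m ∧ 0 < X.κ ∧ 100 * X.κ ≤ X.m ∧ 4 * X.m < X.w₁ ∧ X.w₁ + 8 * X.m ≤ X.w₂ := by
  obtain ⟨hm, hκ, hκm, hr₁, hw₁, hw₂, hrs, hr₁', hr₁₂, hr₂'⟩ := X.radii'
  exact ⟨hm, hκ, hκm, by linarith, by linarith⟩

/-- **Four rough positions at prescribed heights do not exist.** [folklore] -/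
theorem false_of_heights {a b c e : ℕ} (hab : a < b) (hbc : b < c) (hce : c < e) (he : e < a + X.N)
    (ha : a ∉ X.rim) (hb : b ∉ X.rim) (hc : c ∉ X.rim) (he' : e ∉ X.rim)
    (hhb : a ∈ X.lft ↔ b ∈ X.lft) (hhc : a ∈ X.lft ↔ c ∈ X.lft)
    {ℓ : ℝ} (hla : |X.hgt a - ℓ| ≤ X.κ) (hlc : |X.hgt c - ℓ| ≤ X.κ)
    (hfb : X.hgt b + X.m / 2 + 3 * X.κ ≤ ℓ ∨ ℓ + X.m / 2 + 3 * X.κ ≤ X.hgt b)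
    (hfe : (a ∈ X.lft ↔ e ∈ X.lft) → (X.hgt e + X.m / 2 + 3 * X.κ ≤ ℓ ∨ ℓ + X.m / 2 + 3 * X.κ ≤ X.hgt e)) :
    False := by
  obtain ⟨hm, hκ, hκm, hw₁, hw₂⟩ := X.numer
  rw [abs_le] at hla hlc
  have hwa := (X.hgt_mem a).1
  refine X.false_of_far hab hbc hce he ha hb hc he' fun q hq => ?_
  rcases X.lft_or_rgt ha with hL | hR
  · -- left hand: `u ≈ -hgt`
    have hbL := hhb.1 hL
    have hcL := hhc.1 hL
    obtain ⟨ua1, ua2⟩ := X.u_of_lft hL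
    obtain ⟨uc1, uc2⟩ := X.u_of_lft hcL
    have hmax : max (X.u a) (X.u c) ≤ -ℓ + 2 * X.κ := max_le (by linarith) (by linarith)
    have hmin : -ℓ - 2 * X.κ ≤ min (X.u a) (X.u c) := le_min (by linarith) (by linarith)
    -- a generic step
    have key : ∀ i, i ∈ X.lft → (X.hgt i + X.m / 2 + 3 * X.κ ≤ ℓ ∨ ℓ + X.m / 2 + 3 * X.κ ≤ X.hgt i) →
        X.u i + X.m / 2 ≤ min (X.u a) (X.u c) ∨ max (X.u a) (X.u c) + X.m / 2 ≤ X.u i := by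
      intro i hi hf
      obtain ⟨u1, u2⟩ := X.u_of_lft hi
      rcases hf with h | h
      · right; linarith
      · left; linarith
    rcases hq with rfl | rfl
    · exact key b hbL hfb
    · rcases X.lft_or_rgt he' with heL | heR
      · exact key e heL (hfe (iff_of_true hL heL))
      · right; have := X.le_u_of_rgt heR; linarith
  · -- right hand: `u ≈ hgt`
    have hbR : b ∈ X.rgt := by
      rcases X.lft_or_rgt hb with h | h
      · exact absurd (hhb.2 h) fun h' => (not_lt.2 (X.le_u_of_rgt hR)) (by linarith [h'.2, X.hκ, hw₁, hm])
      · exact h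
    have hcR : c ∈ X.rgt := by
      rcases X.lft_or_rgt hc with h | h
      · exact absurd (hhc.2 h) fun h' => (not_lt.2 (X.le_u_of_rgt hR)) (by linarith [h'.2, X.hκ, hw₁, hm])
      · exact h
    obtain ⟨ua1, ua2⟩ := X.u_of_rgt hR
    obtain ⟨uc1, uc2⟩ := X.u_of_rgt hcR
    have hmax : max (X.u a) (X.u c) ≤ ℓ + 2 * X.κ := max_le (by linarith) (by linarith)
    have hmin : ℓ - 2 * X.κ ≤ min (X.u a) (X.u c) := le_min (by linarith) (by linarith)
    have key : ∀ i, i ∈ X.rgt → (X.hgt i + X.m / 2 + 3 * X.κ ≤ ℓ ∨ ℓ + X.m / 2 + 3 * X.κ ≤ X.hgt i) →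
        X.u i + X.m / 2 ≤ min (X.u a) (X.u c) ∨ max (X.u a) (X.u c) + X.m / 2 ≤ X.u i := by
      intro i hi hf
      obtain ⟨u1, u2⟩ := X.u_of_rgt hi
      rcases hf with h | h
      · left; linarith
      · right; linarith
    rcases hq with rfl | rfl
    · exact key b hbR hfb
    · rcases X.lft_or_rgt he' with heL | heR
      · left; have := X.u_le_of_lft heL; linarith
      · refine key e heR (hfe ⟨fun h => absurd hR fun h' => ?_, fun h => absurd heR fun h' => ?_⟩)
        · linarith [h.2, h'.2]
        · linarith [h.2, h'.2]

/-- Height one step earlier/later. [folklore] -/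
theorem hgt_succ_bounds (i : ℕ) : X.hgt i - X.κ ≤ X.hgt (i + 1) ∧ X.hgt (i + 1) ≤ X.hgt i + X.κ := by
  have h := abs_le.1 (X.abs_hgt_sub_le i); constructor <;> linarith [h.1, h.2]

/-- **A descent followed by an ascent are of different hands** (valley). [folklore] -/
theorem hands_ne_of_valley {Q P P' R : ℕ} (hQP : Q < P) (hPP' : P ≤ P') (hP'R : P' < R) (hRN : R ≤ Q + X.N)
    (hQ : X.w₂ - X.κ < X.hgt Q) (hP : X.hgt P < X.w₁ + X.κ) (hP' : X.hgt P' < X.w₁ + X.κ) (hR : X.w₂ - X.κ < X.hgt R)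
    (hmid₁ : ∀ i, Q < i → i < P → X.w₁ + X.κ ≤ X.hgt i ∧ X.hgt i ≤ X.w₂ - X.κ)
    (hmid₂ : ∀ i, P' < i → i < R → X.w₁ + X.κ ≤ X.hgt i ∧ X.hgt i ≤ X.w₂ - X.κ) :
    ¬ (Q + 1 ∈ X.lft ↔ P' + 1 ∈ X.lft) := by
  intro hiff
  obtain ⟨hm, hκ, hκm, hw₁, hw₂⟩ := X.numer
  have hr₁ : ∀ i, Q + 1 ≤ i → i ≤ P - 1 → i ∉ X.rim := fun i h1 h2 =>
    X.not_rim_of_mid (hmid₁ i (by omega) (by omega)).1 (hmid₁ i (by omega) (by omega)).2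
  have hr₂ : ∀ i, P' + 1 ≤ i → i ≤ R - 1 → i ∉ X.rim := fun i h1 h2 =>
    X.not_rim_of_mid (hmid₂ i (by omega) (by omega)).1 (hmid₂ i (by omega) (by omega)).2
  have hQ1 := (X.hgt_succ_bounds Q).1
  have hR1 : X.hgt R - X.κ ≤ X.hgt (R - 1) := by
    have := (X.hgt_succ_bounds (R - 1)).2; rw [Nat.sub_add_cancel (by omega)] at this; linarith
  -- the four positions
  obtain ⟨a₂, ha₂1, ha₂2, ha₂3, ha₂4⟩ := exists_last_ge (h := X.hgt) (ℓ := X.w₁ + 2 * X.m) (s := Q + 1) (t := P)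
    (by omega) (by linarith) (by linarith)
  have ha₂5 : X.hgt a₂ < X.w₁ + 2 * X.m + X.κ := by
    have := ha₂4 (a₂ + 1) (by omega) (by omega); linarith [(X.hgt_succ_bounds a₂).1]
  obtain ⟨a₃, ha₃1, ha₃2, ha₃3, ha₃4⟩ := exists_last_ge (h := X.hgt) (ℓ := X.w₁ + X.m) (s := a₂) (t := P)
    ha₂2.le (by linarith) (by linarith)
  have ha₃5 : X.hgt a₃ < X.w₁ + X.m + X.κ := by
    have := ha₃4 (a₃ + 1) (by omega) (by omega); linarith [(X.hgt_succ_bounds a₃).1]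
  have ha₂₃ : a₂ < a₃ := lt_of_le_of_ne ha₃1 fun e => by rw [e] at ha₂3; linarith
  obtain ⟨b₂, hb₂1, hb₂2, hb₂3, hb₂4⟩ := exists_first_ge (h := X.hgt) (ℓ := X.w₁ + 2 * X.m) (s := P') (t := R - 1)
    (by omega) (by linarith) (by linarith)
  have hb₂5 : X.hgt b₂ < X.w₁ + 2 * X.m + X.κ := by
    have := hb₂4 (b₂ - 1) (by omega) (by omega)
    have h2 := (X.hgt_succ_bounds (b₂ - 1)).2; rw [Nat.sub_add_cancel (by omega)] at h2; linarith
  obtain ⟨b₁, hb₁1, hb₁2, hb₁3, hb₁4⟩ := exists_first_ge (h := X.hgt) (ℓ := X.w₁ + 3 * X.m) (s := b₂) (t := R - 1)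
    hb₂2 (by linarith) (by linarith)
  -- hands
  have hI₁ : ∀ i, Q + 1 ≤ i → i ≤ P - 1 → (i ∈ X.lft ↔ Q + 1 ∈ X.lft) := fun i h1 h2 =>
    X.lft_iff_of_interval hr₁ h1 h2 le_rfl (by omega)
  have hI₂ : ∀ i, P' + 1 ≤ i → i ≤ R - 1 → (i ∈ X.lft ↔ P' + 1 ∈ X.lft) := fun i h1 h2 =>
    X.lft_iff_of_interval hr₂ h1 h2 le_rfl (by omega)
  have e₂ := hI₁ a₂ ha₂1 (by omega)
  have e₃ := hI₁ a₃ (by omega) (by omega)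
  have f₂ := hI₂ b₂ (by omega) hb₂2
  have f₁ := hI₂ b₁ (by omega) hb₁2
  refine X.false_of_heights (a := a₂) (b := a₃) (c := b₂) (e := b₁) ha₂₃ (by omega) hb₁1 (by omega)
    (hr₁ a₂ ha₂1 (by omega)) (hr₁ a₃ (by omega) (by omega)) (hr₂ b₂ (by omega) hb₂2) (hr₂ b₁ (by omega) hb₁2)
    (e₂.trans e₃.symm) (e₂.trans (hiff.trans f₂.symm)) (ℓ := X.w₁ + 2 * X.m)
    (abs_le.2 ⟨by linarith, by linarith⟩) (abs_le.2 ⟨by linarith, by linarith⟩) (Or.inl (by linarith))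
    fun _ => Or.inr (by linarith)

/-- **An ascent followed by a descent are of different hands** (peak). [folklore] -/
theorem hands_ne_of_peak {Q P P' R : ℕ} (hQP : Q < P) (hPP' : P ≤ P') (hP'R : P' < R) (hRN : R ≤ Q + X.N)
    (hQ : X.hgt Q < X.w₁ + X.κ) (hP : X.w₂ - X.κ < X.hgt P) (hP' : X.w₂ - X.κ < X.hgt P') (hR : X.hgt R < X.w₁ + X.κ)
    (hmid₁ : ∀ i, Q < i → i < P → X.w₁ + X.κ ≤ X.hgt i ∧ X.hgt i ≤ X.w₂ - X.κ)
    (hmid₂ : ∀ i, P' < i → i < R → X.w₁ + X.κ ≤ X.hgt i ∧ X.hgt i ≤ X.w₂ - X.κ) :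
    ¬ (Q + 1 ∈ X.lft ↔ P' + 1 ∈ X.lft) := by
  intro hiff
  obtain ⟨hm, hκ, hκm, hw₁, hw₂⟩ := X.numer
  have hr₁ : ∀ i, Q + 1 ≤ i → i ≤ P - 1 → i ∉ X.rim := fun i h1 h2 =>
    X.not_rim_of_mid (hmid₁ i (by omega) (by omega)).1 (hmid₁ i (by omega) (by omega)).2
  have hr₂ : ∀ i, P' + 1 ≤ i → i ≤ R - 1 → i ∉ X.rim := fun i h1 h2 =>
    X.not_rim_of_mid (hmid₂ i (by omega) (by omega)).1 (hmid₂ i (by omega) (by omega)).2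
  have hQ1 := (X.hgt_succ_bounds Q).2
  have hR1 : X.hgt (R - 1) ≤ X.hgt R + X.κ := by
    have := (X.hgt_succ_bounds (R - 1)).1; rw [Nat.sub_add_cancel (by omega)] at this; linarith
  obtain ⟨a₂, ha₂1, ha₂2, ha₂3, ha₂4⟩ := exists_last_le (h := X.hgt) (ℓ := X.w₂ - 2 * X.m) (s := Q + 1) (t := P)
    (by omega) (by linarith) (by linarith)
  have ha₂5 : X.w₂ - 2 * X.m - X.κ < X.hgt a₂ := by
    have := ha₂4 (a₂ + 1) (by omega) (by omega); linarith [(X.hgt_succ_bounds a₂).2]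
  obtain ⟨a₃, ha₃1, ha₃2, ha₃3, ha₃4⟩ := exists_last_le (h := X.hgt) (ℓ := X.w₂ - X.m) (s := a₂) (t := P)
    ha₂2.le (by linarith) (by linarith)
  have ha₃5 : X.w₂ - X.m - X.κ < X.hgt a₃ := by
    have := ha₃4 (a₃ + 1) (by omega) (by omega); linarith [(X.hgt_succ_bounds a₃).2]
  have ha₂₃ : a₂ < a₃ := lt_of_le_of_ne ha₃1 fun e => by rw [e] at ha₂3; linarith
  obtain ⟨b₂, hb₂1, hb₂2, hb₂3, hb₂4⟩ := exists_first_le (h := X.hgt) (ℓ := X.w₂ - 2 * X.m) (s := P') (t := R - 1)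
    (by omega) (by linarith) (by linarith)
  have hb₂5 : X.w₂ - 2 * X.m - X.κ < X.hgt b₂ := by
    have := hb₂4 (b₂ - 1) (by omega) (by omega)
    have h2 := (X.hgt_succ_bounds (b₂ - 1)).1; rw [Nat.sub_add_cancel (by omega)] at h2; linarith
  obtain ⟨b₁, hb₁1, hb₁2, hb₁3, hb₁4⟩ := exists_first_le (h := X.hgt) (ℓ := X.w₂ - 3 * X.m) (s := b₂) (t := R - 1)
    hb₂2 (by linarith) (by linarith)
  have hI₁ : ∀ i, Q + 1 ≤ i → i ≤ P - 1 → (i ∈ X.lft ↔ Q + 1 ∈ X.lft) := fun i h1 h2 =>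
    X.lft_iff_of_interval hr₁ h1 h2 le_rfl (by omega)
  have hI₂ : ∀ i, P' + 1 ≤ i → i ≤ R - 1 → (i ∈ X.lft ↔ P' + 1 ∈ X.lft) := fun i h1 h2 =>
    X.lft_iff_of_interval hr₂ h1 h2 le_rfl (by omega)
  have e₂ := hI₁ a₂ ha₂1 (by omega)
  have e₃ := hI₁ a₃ (by omega) (by omega)
  have f₂ := hI₂ b₂ (by omega) hb₂2
  have f₁ := hI₂ b₁ (by omega) hb₁2
  refine X.false_of_heights (a := a₂) (b := a₃) (c := b₂) (e := b₁) ha₂₃ (by omega) hb₁1 (by omega)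
    (hr₁ a₂ ha₂1 (by omega)) (hr₁ a₃ (by omega) (by omega)) (hr₂ b₂ (by omega) hb₂2) (hr₂ b₁ (by omega) hb₁2)
    (e₂.trans e₃.symm) (e₂.trans (hiff.trans f₂.symm)) (ℓ := X.w₂ - 2 * X.m)
    (abs_le.2 ⟨by linarith, by linarith⟩) (abs_le.2 ⟨by linarith, by linarith⟩) (Or.inr (by linarith))
    fun _ => Or.inl (by linarith)

/-- **No deep low excursion**: between two low positions joined through mid positions the height stays
`< w₁ + 3m`, given a rough position of height `≥ w₁ + 3m` after them. [folklore] -/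
theorem false_of_low_excursion {s q t e : ℕ} (hsq : s < q) (hqt : q < t) (hte : t ≤ e) (hes : e ≤ s + X.N)
    (hs : X.hgt s < X.w₁ + X.κ) (ht : X.hgt t < X.w₁ + X.κ)
    (hmid : ∀ i, s < i → i < t → X.w₁ + X.κ ≤ X.hgt i ∧ X.hgt i ≤ X.w₂ - X.κ)
    (hq : X.w₁ + 3 * X.m ≤ X.hgt q) (he : e ∉ X.rim) (he' : X.w₁ + 3 * X.m ≤ X.hgt e) : False := by
  obtain ⟨hm, hκ, hκm, hw₁, hw₂⟩ := X.numer
  have hr : ∀ i, s + 1 ≤ i → i ≤ t - 1 → i ∉ X.rim := fun i h1 h2 =>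
    X.not_rim_of_mid (hmid i (by omega) (by omega)).1 (hmid i (by omega) (by omega)).2
  have hs1 := (X.hgt_succ_bounds s).2
  have ht1 : X.hgt (t - 1) ≤ X.hgt t + X.κ := by
    have := (X.hgt_succ_bounds (t - 1)).1; rw [Nat.sub_add_cancel (by omega)] at this; linarith
  obtain ⟨a₂, ha₂1, ha₂2, ha₂3, ha₂4⟩ := exists_last_le (h := X.hgt) (ℓ := X.w₁ + 2 * X.m) (s := s + 1) (t := q)
    (by omega) (by linarith) (by linarith)
  have ha₂5 : X.w₁ + 2 * X.m - X.κ < X.hgt a₂ := by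
    have := ha₂4 (a₂ + 1) (by omega) (by omega); linarith [(X.hgt_succ_bounds a₂).2]
  obtain ⟨c₂, hc₂1, hc₂2, hc₂3, hc₂4⟩ := exists_first_le (h := X.hgt) (ℓ := X.w₁ + 2 * X.m) (s := q) (t := t - 1)
    (by omega) (by linarith) (by linarith)
  have hc₂5 : X.w₁ + 2 * X.m - X.κ < X.hgt c₂ := by
    have := hc₂4 (c₂ - 1) (by omega) (by omega)
    have h2 := (X.hgt_succ_bounds (c₂ - 1)).1; rw [Nat.sub_add_cancel (by omega)] at h2; linarith
  have hI : ∀ i, s + 1 ≤ i → i ≤ t - 1 → (i ∈ X.lft ↔ s + 1 ∈ X.lft) := fun i h1 h2 =>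
    X.lft_iff_of_interval hr h1 h2 le_rfl (by omega)
  have e₁ := hI a₂ ha₂1 (by omega)
  have e₂ := hI q (by omega) (by omega)
  have e₃ := hI c₂ (by omega) hc₂2
  exact X.false_of_heights (a := a₂) (b := q) (c := c₂) (e := e) ha₂2 hc₂1 (by omega) (by omega)
    (hr a₂ ha₂1 (by omega)) (hr q (by omega) (by omega)) (hr c₂ (by omega) hc₂2) he
    (e₁.trans e₂.symm) (e₁.trans e₃.symm) (ℓ := X.w₁ + 2 * X.m)
    (abs_le.2 ⟨by linarith, by linarith⟩) (abs_le.2 ⟨by linarith, by linarith⟩) (Or.inr (by linarith))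
    fun _ => Or.inr (by linarith)

/-- **No deep high excursion**: between two high positions joined through mid positions the height stays
`> w₂ - 3m`, given a rough position of height `≤ w₂ - 3m` after them. [folklore] -/
theorem false_of_high_excursion {s q t e : ℕ} (hsq : s < q) (hqt : q < t) (hte : t ≤ e) (hes : e ≤ s + X.N)
    (hs : X.w₂ - X.κ < X.hgt s) (ht : X.w₂ - X.κ < X.hgt t)
    (hmid : ∀ i, s < i → i < t → X.w₁ + X.κ ≤ X.hgt i ∧ X.hgt i ≤ X.w₂ - X.κ)
    (hq : X.hgt q ≤ X.w₂ - 3 * X.m) (he : e ∉ X.rim) (he' : X.hgt e ≤ X.w₂ - 3 * X.m) : False := by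
  obtain ⟨hm, hκ, hκm, hw₁, hw₂⟩ := X.numer
  have hr : ∀ i, s + 1 ≤ i → i ≤ t - 1 → i ∉ X.rim := fun i h1 h2 =>
    X.not_rim_of_mid (hmid i (by omega) (by omega)).1 (hmid i (by omega) (by omega)).2
  have hs1 := (X.hgt_succ_bounds s).1
  have ht1 : X.hgt t - X.κ ≤ X.hgt (t - 1) := by
    have := (X.hgt_succ_bounds (t - 1)).2; rw [Nat.sub_add_cancel (by omega)] at this; linarith
  obtain ⟨a₂, ha₂1, ha₂2, ha₂3, ha₂4⟩ := exists_last_ge (h := X.hgt) (ℓ := X.w₂ - 2 * X.m) (s := s + 1) (t := q)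
    (by omega) (by linarith) (by linarith)
  have ha₂5 : X.hgt a₂ < X.w₂ - 2 * X.m + X.κ := by
    have := ha₂4 (a₂ + 1) (by omega) (by omega); linarith [(X.hgt_succ_bounds a₂).1]
  obtain ⟨c₂, hc₂1, hc₂2, hc₂3, hc₂4⟩ := exists_first_ge (h := X.hgt) (ℓ := X.w₂ - 2 * X.m) (s := q) (t := t - 1)
    (by omega) (by linarith) (by linarith)
  have hc₂5 : X.hgt c₂ < X.w₂ - 2 * X.m + X.κ := by
    have := hc₂4 (c₂ - 1) (by omega) (by omega)
    have h2 := (X.hgt_succ_bounds (c₂ - 1)).2; rw [Nat.sub_add_cancel (by omega)] at h2; linarith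
  have hI : ∀ i, s + 1 ≤ i → i ≤ t - 1 → (i ∈ X.lft ↔ s + 1 ∈ X.lft) := fun i h1 h2 =>
    X.lft_iff_of_interval hr h1 h2 le_rfl (by omega)
  have e₁ := hI a₂ ha₂1 (by omega)
  have e₂ := hI q (by omega) (by omega)
  have e₃ := hI c₂ (by omega) hc₂2
  exact X.false_of_heights (a := a₂) (b := q) (c := c₂) (e := e) ha₂2 hc₂1 (by omega) (by omega)
    (hr a₂ ha₂1 (by omega)) (hr q (by omega) (by omega)) (hr c₂ (by omega) hc₂2) he
    (e₁.trans e₂.symm) (e₁.trans e₃.symm) (ℓ := X.w₂ - 2 * X.m)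
    (abs_le.2 ⟨by linarith, by linarith⟩) (abs_le.2 ⟨by linarith, by linarith⟩) (Or.inl (by linarith))
    fun _ => Or.inl (by linarith)

end WSetting

end WindowRect

/-- **No deep low excursion of the height along the boundary cycle**, closed form (registered sub-goal of
stmt-CriticalPhenomena-10650). [folklore] -/
theorem windowRect_false_of_low_excursion : ∀ (X : WindowRect.WSetting) {s q t e : ℕ}, s < q → q < t → t ≤ e → e ≤ s + X.N → X.hgt s < X.w₁ + X.κ → X.hgt t < X.w₁ + X.κ → (∀ i, s < i → i < t → X.w₁ + X.κ ≤ X.hgt i ∧ X.hgt i ≤ X.w₂ - X.κ) → X.w₁ + 3 * X.m ≤ X.hgt q → e ∉ X.rim → X.w₁ + 3 * X.m ≤ X.hgt e → False :=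
  fun X _ _ _ _ hsq hqt hte hes hs ht hmid hq he he' => X.false_of_low_excursion hsq hqt hte hes hs ht hmid hq he he'

end Summit.CriticalPhenomena.SAWScalingLimit.Theorems.IsingBoundaryRatio

end
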